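import Summits.CriticalPhenomena.PercolationContinuityZ3.Theorems.PercNearOneGluingNoHeavyLowerTailQ7PsiStarAux
import HarnessLib

/-!
# `NoHeavyLowerTail` (stmt-CriticalPhenomena-4575) — the peeled form of Question 7 on Kozma–Nitzan's
# Theorem-4 class for ANY number of relays, for every monotone cluster property

Support file (`--supports stmt-CriticalPhenomena-4575`), coupling seat `prim-cplus-coupling` (gen 5).  No
definitions, no named facts, no sorries.

* `Q7Psi.gpsi_star` — **Theorem (designated form of Kozma–Nitzan's Theorem 4 / Theorem 8, every `|A|`).**  Finite
  weighted graph on `V`; observer `o`; a finite set `A` of "strong" relays and a relay `z ∉ A`, `o ∉ A`, `z ≠ o`,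
  such that every pair `s(o,u)` with `u ∉ A ∪ {z}` has weight `0` (Kozma–Nitzan's class "`0` isolated in
  `G ∖ A`", arXiv:2401.12397, Theorem 4, pp. 12–14); `F` a monotone function of vertex sets (monotone cluster
  property, §5.1 p. 31).  If `E F(C(z)) ≤ E F(C(a))` for every `a ∈ A`, then
  `E[F(C(z)); o ↔ A] ≤ E[F(C(o)); o ↔ A]`.
  (Kozma–Nitzan's Theorems 4/8 give the MIN version — some relay; here the weak relay is designated as the one
  with the least mean, as in Question 7, p. 36.  The case `|A| = 2` is `Q7Psi.gpsi_three_star`.)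
  Proof (seat memo A5-COUPLING-gen5.md §12): partition along the stars `σ_B` of `o`, `B ⊆ A ∪ {z}`
  (`KNPreFKG.setIntegral_eq_sum_inter_starEvent`).  With `αᵃ := E[F(X'ₐ) − F(Z')]` the off-`o` means:
  if all `αᵃ ≥ 0`, every star term of `Ψ := E[F(C o) − F(C z); o↔A]` is `≥ 0`; otherwise, for `i ∈ A`
  minimising `αⁱ` (`< 0`), every star term of `Ψ − Δᵢ` (`Δᵢ := E F(C aᵢ) − E F(C z) ≥ 0`) is `≥ 0`.  Each
  star term is an integral over the graph without `o` (independence of the star, `KNPreFKG.setIntegral_starEvent_comp_restrict`)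
  signed by Kozma–Nitzan's Lemma 3(ii) for real cluster properties (`KozmaNitzan2024_lemma3_ii_real`) — with
  the weak vertex `z` (first case), resp. `aᵢ` against `z` or against a port `aⱼ ∈ B` (second case; this is where
  the minimality of `αⁱ` enters).
[cite: KozmaNitzan2024, Question 7 (p. 36), Theorem 4 and Lemma 5 (pp. 12–14), Lemma 3(ii) (pp. 6–7), §5.1 (pp. 31–32)]
-/

namespace Summit.CriticalPhenomena.PercolationContinuityZ3.Theorems

open MeasureTheory Set Literature.Probability.LatticeModels Literature.Probability.Percolation
open scoped Classical
open KNPreFKG Q7Psi.Star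

noncomputable section

namespace Q7Psi

variable {V : Type*}

/-! ### Two pointwise bounds under a star `σ_B` -/

/-- Under `σ_B`, for a port `j ∈ B ∖ {o}` and any `a ≠ o`:
`F(C(o)) − F(C(a)) ≥ 𝟙{a ↮ B off o}·(F(X'ⱼ) − F(X'ₐ))` (`X'` = clusters off `o`).
[cite: KozmaNitzan2024, Lemma 5 (p. 13)] -/
theorem star_diff_ge (F : Set V → ℝ) (hF : ∀ S T : Set V, S ⊆ T → F S ≤ F T) {ω : BondConfig V} {o : V}
    {B : Set V} (hσ : ω ∈ starEvent o B) {j a : V} (hjB : j ∈ B) (hjo : j ≠ o) (hao : a ≠ o) :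
    {ω' : BondConfig V | ∀ u ∈ B, u ≠ o → ω' ∉ openConnIn ({o}ᶜ : Set V) a u}.indicator
        (fun ω' => F {v | ω' ∈ openConnIn ({o}ᶜ : Set V) j v} - F {v | ω' ∈ openConnIn ({o}ᶜ : Set V) a v}) ω ≤
      F (openCluster ω o) - F (openCluster ω a) := by
  by_cases h : ω ∈ {ω' : BondConfig V | ∀ u ∈ B, u ≠ o → ω' ∉ openConnIn ({o}ᶜ : Set V) a u}
  · rw [indicator_of_mem h]
    rw [openCluster_of_off hσ hao (fun u huB huo => h u huB huo), openCluster_o hσ]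
    have hsub : {v | ω ∈ openConnIn ({o}ᶜ : Set V) j v} ⊆
        {o} ∪ {v | ∃ u ∈ B, u ≠ o ∧ ω ∈ openConnIn ({o}ᶜ : Set V) u v} := fun v hv => Or.inr ⟨j, hjB, hjo, hv⟩
    linarith [hF _ _ hsub]
  · rw [indicator_of_notMem h]
    simp only [mem_setOf_eq, not_forall, not_not, exists_prop] at h
    obtain ⟨u, huB, huo, hau⟩ := h
    rw [openCluster_of_on hσ huB huo hau, sub_self]

/-- Under a star `σ_B` containing `z`, for any `a ≠ o`:
`F(C(a)) − F(C(z)) ≤ 𝟙{a ↮ B off o}·(F(X'ₐ) − F(Z'))`. [cite: KozmaNitzan2024, Lemma 5 (p. 13)] -/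
theorem star_diff_le (F : Set V → ℝ) (hF : ∀ S T : Set V, S ⊆ T → F S ≤ F T) {ω : BondConfig V} {o : V}
    {B : Set V} (hσ : ω ∈ starEvent o B) {z a : V} (hzB : z ∈ B) (hzo : z ≠ o) (hao : a ≠ o) :
    F (openCluster ω a) - F (openCluster ω z) ≤
      {ω' : BondConfig V | ∀ u ∈ B, u ≠ o → ω' ∉ openConnIn ({o}ᶜ : Set V) a u}.indicator
        (fun ω' => F {v | ω' ∈ openConnIn ({o}ᶜ : Set V) a v} - F {v | ω' ∈ openConnIn ({o}ᶜ : Set V) z v}) ω := by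
  have hCz : openCluster ω z = openCluster ω o :=
    openCluster_of_on hσ hzB hzo (openConnIn_rfl (mem_compl_singleton_iff.2 hzo) ω)
  by_cases h : ω ∈ {ω' : BondConfig V | ∀ u ∈ B, u ≠ o → ω' ∉ openConnIn ({o}ᶜ : Set V) a u}
  · rw [indicator_of_mem h]
    rw [openCluster_of_off hσ hao (fun u huB huo => h u huB huo), hCz, openCluster_o hσ]
    have hsub : {v | ω ∈ openConnIn ({o}ᶜ : Set V) z v} ⊆
        {o} ∪ {v | ∃ u ∈ B, u ≠ o ∧ ω ∈ openConnIn ({o}ᶜ : Set V) u v} := fun v hv => Or.inr ⟨z, hzB, hzo, hv⟩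
    linarith [hF _ _ hsub]
  · rw [indicator_of_notMem h]
    simp only [mem_setOf_eq, not_forall, not_not, exists_prop] at h
    obtain ⟨u, huB, huo, hau⟩ := h
    rw [openCluster_of_on hσ huB huo hau, hCz, sub_self]

variable [Fintype V]

/-- **The star integral signed by Lemma 3(ii) off `o`.**  For `p, q ≠ o` with `E F(X'ₚ) ≤ E F(X'_q)` (means of the
off-`o` clusters) and any `B`:
`0 ≤ ∫_{σ_B} 𝟙{p ↮ B off o}·(F(X'_q) − F(X'ₚ)) dμ` — the star is independent of the pairs off `o`, and on `{o}ᶜ`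
the event `{p ↮ B}` is decreasing in the cluster of `p` (Kozma–Nitzan's Lemma 3(ii), real form).
[cite: KozmaNitzan2024, Lemma 3(ii) (pp. 6–7), Lemma 5 (p. 13)] -/
theorem star_integral_nonneg (w : Sym2 V → unitInterval) (o p q : V) (hpo : p ≠ o) (hqo : q ≠ o) (B : Set V)
    (F : Set V → ℝ) (hF : ∀ S T : Set V, S ⊆ T → F S ≤ F T)
    (hpq : ∫ ω, F {v | ω ∈ openConnIn ({o}ᶜ : Set V) p v} ∂(prodBernoulli w) ≤
      ∫ ω, F {v | ω ∈ openConnIn ({o}ᶜ : Set V) q v} ∂(prodBernoulli w)) :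
    0 ≤ ∫ ω in starEvent o B, {ω' : BondConfig V | ∀ u ∈ B, u ≠ o → ω' ∉ openConnIn ({o}ᶜ : Set V) p u}.indicator
      (fun ω' => F {v | ω' ∈ openConnIn ({o}ᶜ : Set V) q v} - F {v | ω' ∈ openConnIn ({o}ᶜ : Set V) p v}) ω
        ∂(prodBernoulli w) := by
  classical
  set μ := prodBernoulli w with hμ
  set S : Set V := {o}ᶜ with hS
  haveI : Fintype S := Fintype.ofFinite S
  set r := restrictConfig (Subtype.val : S → V) with hr
  set w' : Sym2 S → unitInterval := w ∘ Sym2.map (Subtype.val : S → V) with hw'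
  set μ' := prodBernoulli w' with hμ'
  set p' : S := ⟨p, mem_compl_singleton_iff.2 hpo⟩ with hp'
  set q' : S := ⟨q, mem_compl_singleton_iff.2 hqo⟩ with hq'
  set F' : Set S → ℝ := fun T => F (Subtype.val '' T) with hF'
  have hF'mono : ∀ T T' : Set S, T ⊆ T' → F' T ≤ F' T' := fun T T' hTT' => hF _ _ (image_mono hTT')
  have hmeasS : ∀ T : Set (BondConfig S), MeasurableSet T := fun _ => MeasurableSet.of_discrete
  have hint' : ∀ (k : BondConfig S → ℝ) (T : Set (BondConfig S)), IntegrableOn k T μ' :=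
    fun k T => (Integrable.of_finite).integrableOn
  have tr : ∀ k : BondConfig S → ℝ, ∫ ω, k (r ω) ∂μ = ∫ ω', k ω' ∂μ' := fun k => by
    rw [hμ', hw', hr, integral_comp_restrictConfig_val]
  -- the decreasing event `{p' ↮ B'}` and the integrand on `{o}ᶜ`
  set B' : Set S := {u' | (u' : V) ∈ B} with hB'
  set N : Set (BondConfig S) := {ω' | ∀ u' ∈ B', ¬ (openGraph ω').Reachable p' u'} with hN
  set NV : Set (BondConfig V) := {ω' | ∀ u ∈ B, u ≠ o → ω' ∉ openConnIn ({o}ᶜ : Set V) p u} with hNV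
  set k : BondConfig S → ℝ := N.indicator fun ω' => F' (openCluster ω' q') - F' (openCluster ω' p') with hk
  have hNr : ∀ ω, ω ∈ NV ↔ r ω ∈ N := by
    intro ω
    constructor
    · intro h u' hu' hru
      exact h u' hu' (mem_compl_singleton_iff.1 u'.2) ((reachable_restrictConfig_val_iff S ω p' u').1 hru)
    · intro h u huB huo hpu
      exact h ⟨u, mem_compl_singleton_iff.2 huo⟩ huB ((reachable_restrictConfig_val_iff S ω p' ⟨u, _⟩).2 hpu)
  have hkr : ∀ ω, k (r ω) = NV.indicator
      (fun ω' => F {v | ω' ∈ openConnIn ({o}ᶜ : Set V) q v} - F {v | ω' ∈ openConnIn ({o}ᶜ : Set V) p v}) ω := by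
    intro ω
    by_cases h : ω ∈ NV
    · rw [indicator_of_mem h, hk, indicator_of_mem ((hNr ω).1 h)]
      simp only [hF']
      rw [setOf_openConnIn_eq_image o ω q', setOf_openConnIn_eq_image o ω p']
    · rw [indicator_of_notMem h, hk, indicator_of_notMem (fun h' => h ((hNr ω).2 h'))]
  -- independence of the star, change of variables to `{o}ᶜ`
  have e1 : ∫ ω in starEvent o B, NV.indicator
      (fun ω' => F {v | ω' ∈ openConnIn ({o}ᶜ : Set V) q v} - F {v | ω' ∈ openConnIn ({o}ᶜ : Set V) p v}) ω ∂μ =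
      μ.real (starEvent o B) * ∫ ω', k ω' ∂μ' := by
    rw [← tr k, ← setIntegral_starEvent_comp_restrict w o B k]
    exact setIntegral_congr_fun (MeasurableSet.of_discrete) fun ω _ => (hkr ω).symm
  rw [e1]
  refine mul_nonneg measureReal_nonneg ?_
  -- Lemma 3(ii) on `{o}ᶜ`
  have hyp' : ∫ ω', F' (openCluster ω' p') ∂μ' ≤ ∫ ω', F' (openCluster ω' q') ∂μ' := by
    have ep : ∫ ω, F {v | ω ∈ openConnIn ({o}ᶜ : Set V) p v} ∂μ = ∫ ω', F' (openCluster ω' p') ∂μ' := by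
      rw [← tr]; refine integral_congr_ae (Filter.Eventually.of_forall fun ω => ?_)
      simp only [hF']; rw [setOf_openConnIn_eq_image o ω p']
    have eq_ : ∫ ω, F {v | ω ∈ openConnIn ({o}ᶜ : Set V) q v} ∂μ = ∫ ω', F' (openCluster ω' q') ∂μ' := by
      rw [← tr]; refine integral_congr_ae (Filter.Eventually.of_forall fun ω => ?_)
      simp only [hF']; rw [setOf_openConnIn_eq_image o ω q']
    rw [← ep, ← eq_]; exact hpq
  have hN_eq : N = {ω' | openEdgeCluster ω' p' ∈ disconnFamily p' B'} := setOf_forall_not_reachable_eq p' B'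
  have L3 := KozmaNitzan2024_lemma3_ii_real w' p' q' F' hF'mono hyp' (isLowerSet_disconnFamily p' B')
  rw [← hN_eq] at L3
  rw [hk, integral_indicator (hmeasS N), integral_sub (hint' _ _) (hint' _ _)]
  linarith

/-- **Designated form of Kozma–Nitzan's Theorem 4, every `|A|`, every monotone cluster property.**
[cite: KozmaNitzan2024, Question 7 (p. 36), Theorem 4 and Lemma 5 (pp. 12–14), Lemma 3(ii) (pp. 6–7), §5.1 (pp. 31–32)] -/
theorem gpsi_star (w : Sym2 V → unitInterval) (o z : V) (A : Finset V) (hoA : o ∉ A) (hzA : z ∉ A) (hzo : z ≠ o)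
    (hiso : ∀ u, u ≠ o → u ∉ insert z A → w s(o, u) = 0)
    (F : Set V → ℝ) (hF : ∀ S T : Set V, S ⊆ T → F S ≤ F T)
    (hyp : ∀ a ∈ A, ∫ ω, F (openCluster ω z) ∂(prodBernoulli w) ≤ ∫ ω, F (openCluster ω a) ∂(prodBernoulli w)) :
    ∫ ω in (⋃ a ∈ A, openConn o a), F (openCluster ω z) ∂(prodBernoulli w) ≤
      ∫ ω in (⋃ a ∈ A, openConn o a), F (openCluster ω o) ∂(prodBernoulli w) := by
  classical
  set μ := prodBernoulli w with hμ
  have hmeas : ∀ T : Set (BondConfig V), MeasurableSet T := fun _ => MeasurableSet.of_discrete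
  have hint : ∀ (k : BondConfig V → ℝ) (T : Set (BondConfig V)), IntegrableOn k T μ :=
    fun k T => (Integrable.of_finite).integrableOn
  set J : Set (BondConfig V) := ⋃ a ∈ A, (openConn o a : Set (BondConfig V)) with hJ
  set f : BondConfig V → ℝ := fun ω => F (openCluster ω o) - F (openCluster ω z) with hf
  have hao : ∀ a ∈ A, a ≠ o := fun a ha h => hoA (h ▸ ha)
  -- it suffices to show `0 ≤ Ψ := ∫_J f`
  have hΨ : ∫ ω in J, f ω ∂μ = ∫ ω in J, F (openCluster ω o) ∂μ - ∫ ω in J, F (openCluster ω z) ∂μ :=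
    integral_sub (hint _ _) (hint _ _)
  suffices key : 0 ≤ ∫ ω in J, f ω ∂μ by linarith
  -- partition along the stars of `o`
  have ho : o ∉ insert z A := by simp [hzo.symm, hoA]
  have hsumJ := setIntegral_eq_sum_inter_starEvent w (insert z A) o ho hiso J f
  -- the off-`o` means
  set α : V → ℝ := fun a => ∫ ω, (F {v | ω ∈ openConnIn ({o}ᶜ : Set V) a v} -
    F {v | ω ∈ openConnIn ({o}ᶜ : Set V) z v}) ∂μ with hα
  have hαle : ∀ a c : V, α a ≤ α c → ∫ ω, F {v | ω ∈ openConnIn ({o}ᶜ : Set V) a v} ∂μ ≤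
      ∫ ω, F {v | ω ∈ openConnIn ({o}ᶜ : Set V) c v} ∂μ := by
    intro a c h
    simp only [hα] at h
    rw [integral_sub (Integrable.of_finite) (Integrable.of_finite), integral_sub (Integrable.of_finite) (Integrable.of_finite)] at h
    linarith
  have hα0 : ∀ a : V, 0 ≤ α a ↔ ∫ ω, F {v | ω ∈ openConnIn ({o}ᶜ : Set V) z v} ∂μ ≤
      ∫ ω, F {v | ω ∈ openConnIn ({o}ᶜ : Set V) a v} ∂μ := by
    intro a
    simp only [hα]
    rw [integral_sub (Integrable.of_finite) (Integrable.of_finite)]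
    constructor <;> intro h <;> linarith
  -- facts about a star `B ⊆ insert z A`
  have hBo : ∀ B ∈ (insert z A).powerset, ∀ u ∈ (↑B : Set V), u ≠ o := by
    intro B hB u hu h
    have := Finset.mem_powerset.1 hB (Finset.mem_coe.1 hu)
    exact ho (h ▸ this)
  -- (1) stars containing `z` or empty: `∫_{J∩σ_B} f = 0`; other stars: `J ∩ σ_B = σ_B`
  have hTz : ∀ B : Finset V, z ∈ B → ∫ ω in J ∩ starEvent o ↑B, f ω ∂μ = 0 := by
    intro B hzB
    rw [setIntegral_congr_fun (hmeas _) (g := fun _ => (0 : ℝ)) fun ω hω => ?_]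
    · simp
    · exact psiIntegrand_z F hω.2 (Finset.mem_coe.2 hzB) hzo
  have hTempty : ∫ ω in J ∩ starEvent o ↑(∅ : Finset V), f ω ∂μ = 0 := by
    have : J ∩ starEvent o ↑(∅ : Finset V) = ∅ := by
      ext ω
      simp only [hJ, mem_inter_iff, mem_iUnion, exists_prop, mem_empty_iff_false, iff_false, not_and]
      rintro ⟨a, ha, hoa⟩ hσ
      rw [Finset.coe_empty] at hσ
      exact not_reachable_of_empty hσ (hao a ha) hoa
    rw [this, setIntegral_empty]
  have hJB : ∀ B ∈ (insert z A).powerset, z ∉ B → B ≠ ∅ → J ∩ starEvent o ↑B = starEvent o ↑B := by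
    intro B hB hzB hne
    obtain ⟨j, hj⟩ := Finset.nonempty_iff_ne_empty.2 hne
    have hjA : j ∈ A := by
      have := Finset.mem_powerset.1 hB hj
      rcases Finset.mem_insert.1 this with h | h
      · exact absurd (h ▸ hj) hzB
      · exact h
    refine inter_eq_right.2 fun ω hσ => mem_iUnion₂.2 ⟨j, hjA, ?_⟩
    exact (openCluster_x_of_mem hσ (Finset.mem_coe.2 hj) (hao j hjA)).2
  by_cases hall : ∀ a ∈ A, 0 ≤ α a
  · -- CASE 1: all off-`o` means of the strong relays dominate that of `z`: every star term is `≥ 0`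
    rw [hsumJ]
    refine Finset.sum_nonneg fun B hB => ?_
    by_cases hzB : z ∈ B
    · rw [hTz B hzB]
    by_cases hne : B = ∅
    · subst hne; rw [hTempty]
    obtain ⟨j, hj⟩ := Finset.nonempty_iff_ne_empty.2 hne
    have hjA : j ∈ A := by
      have := Finset.mem_powerset.1 hB hj
      rcases Finset.mem_insert.1 this with h | h
      · exact absurd (h ▸ hj) hzB
      · exact h
    rw [hJB B hB hzB hne]
    calc (0 : ℝ) ≤ ∫ ω in starEvent o ↑B, {ω' : BondConfig V | ∀ u ∈ (↑B : Set V), u ≠ o →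
            ω' ∉ openConnIn ({o}ᶜ : Set V) z u}.indicator
          (fun ω' => F {v | ω' ∈ openConnIn ({o}ᶜ : Set V) j v} - F {v | ω' ∈ openConnIn ({o}ᶜ : Set V) z v}) ω ∂μ :=
          star_integral_nonneg w o z j hzo (hao j hjA) ↑B F hF ((hα0 j).1 (hall j hjA))
      _ ≤ ∫ ω in starEvent o ↑B, f ω ∂μ :=
          setIntegral_mono_on (hint _ _) (hint _ _) (hmeas _) fun ω hσ =>
            star_diff_ge F hF hσ (Finset.mem_coe.2 hj) (hao j hjA) hzo
  · -- CASE 2: some strong relay has a smaller off-`o` mean than `z`; take `i` with the least mean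
    push Not at hall
    obtain ⟨i₀, hi₀A, hi₀⟩ := hall
    obtain ⟨i, hiA, himin⟩ := A.exists_min_image α ⟨i₀, hi₀A⟩
    have hαi : α i ≤ 0 := (himin i₀ hi₀A).trans hi₀.le
    have hαiz : α i ≤ α z := by
      have hz0 : α z = 0 := by simp only [hα, sub_self, integral_zero]
      rw [hz0]; exact hαi
    have hio : i ≠ o := hao i hiA
    have hiz : i ≠ z := fun h => hzA (h ▸ hiA)
    -- `Δ_i ≥ 0`, partitioned along the same stars
    set d : BondConfig V → ℝ := fun ω => F (openCluster ω i) - F (openCluster ω z) with hd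
    have hΔ : 0 ≤ ∫ ω, d ω ∂μ := by
      simp only [hd]; rw [integral_sub (Integrable.of_finite) (Integrable.of_finite)]; linarith [hyp i hiA]
    have hsumD := setIntegral_eq_sum_inter_starEvent w (insert z A) o ho hiso univ d
    simp only [univ_inter] at hsumD
    rw [setIntegral_univ] at hsumD
    -- termwise `∫_{J∩σ_B} f - ∫_{σ_B} d ≥ 0`
    have hterm : ∀ B ∈ (insert z A).powerset,
        ∫ ω in starEvent o ↑B, d ω ∂μ ≤ ∫ ω in J ∩ starEvent o ↑B, f ω ∂μ := by
      intro B hB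
      by_cases hzB : z ∈ B
      · -- stars containing `z`
        rw [hTz B hzB]
        calc ∫ ω in starEvent o ↑B, d ω ∂μ
            ≤ ∫ ω in starEvent o ↑B, {ω' : BondConfig V | ∀ u ∈ (↑B : Set V), u ≠ o →
                ω' ∉ openConnIn ({o}ᶜ : Set V) i u}.indicator
              (fun ω' => F {v | ω' ∈ openConnIn ({o}ᶜ : Set V) i v} - F {v | ω' ∈ openConnIn ({o}ᶜ : Set V) z v}) ω ∂μ :=
              setIntegral_mono_on (hint _ _) (hint _ _) (hmeas _) fun ω hσ =>
                star_diff_le F hF hσ (Finset.mem_coe.2 hzB) hzo hio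
          _ ≤ 0 := by
              have h := star_integral_nonneg w o i z hio hzo ↑B F hF (hαle i z hαiz)
              rw [← neg_nonneg, ← integral_neg]
              refine le_trans h (le_of_eq ?_)
              refine integral_congr_ae (Filter.Eventually.of_forall fun ω => ?_)
              simp only [Set.indicator_apply, mem_setOf_eq]
              split_ifs <;> ring
      by_cases hne : B = ∅
      · -- the empty star: `o` isolated, `d = F(X'_i) - F(Z')` off `o`
        subst hne
        rw [hTempty]
        have e : ∫ ω in starEvent o ↑(∅ : Finset V), d ω ∂μ = ∫ ω in starEvent o ↑(∅ : Finset V),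
            {ω' : BondConfig V | ∀ u ∈ (↑(∅ : Finset V) : Set V), u ≠ o → ω' ∉ openConnIn ({o}ᶜ : Set V) i u}.indicator
              (fun ω' => F {v | ω' ∈ openConnIn ({o}ᶜ : Set V) i v} - F {v | ω' ∈ openConnIn ({o}ᶜ : Set V) z v}) ω ∂μ := by
          refine setIntegral_congr_fun (hmeas _) fun ω hσ => ?_
          have hmem : ω ∈ {ω' : BondConfig V | ∀ u ∈ (↑(∅ : Finset V) : Set V), u ≠ o →
              ω' ∉ openConnIn ({o}ᶜ : Set V) i u} := by
            intro u hu; simp at hu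
          rw [indicator_of_mem hmem, hd]
          rw [Finset.coe_empty] at hσ
          exact diffIntegrand_empty F hσ hio hzo
        rw [e]
        have h := star_integral_nonneg w o i z hio hzo ↑(∅ : Finset V) F hF (hαle i z hαiz)
        rw [← neg_nonneg, ← integral_neg]
        refine le_trans h (le_of_eq ?_)
        refine integral_congr_ae (Filter.Eventually.of_forall fun ω => ?_)
        simp only [Set.indicator_apply, mem_setOf_eq]
        split_ifs <;> ring
      -- nonempty stars of strong relays
      rw [hJB B hB hzB hne]
      by_cases hiB : i ∈ B
      · -- stars containing `i`: `C(i) = C(o)`, the two integrands agree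
        refine le_of_eq (setIntegral_congr_fun (hmeas _) fun ω hσ => ?_)
        simp only [hd, hf, (openCluster_x_of_mem hσ (Finset.mem_coe.2 hiB) hio).1]
      · obtain ⟨j, hj⟩ := Finset.nonempty_iff_ne_empty.2 hne
        have hjA : j ∈ A := by
          have := Finset.mem_powerset.1 hB hj
          rcases Finset.mem_insert.1 this with h | h
          · exact absurd (h ▸ hj) hzB
          · exact h
        have hij : α i ≤ α j := himin j hjA
        rw [← sub_nonneg, ← integral_sub (hint _ _) (hint _ _)]
        calc (0 : ℝ) ≤ ∫ ω in starEvent o ↑B, {ω' : BondConfig V | ∀ u ∈ (↑B : Set V), u ≠ o →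
                ω' ∉ openConnIn ({o}ᶜ : Set V) i u}.indicator
              (fun ω' => F {v | ω' ∈ openConnIn ({o}ᶜ : Set V) j v} - F {v | ω' ∈ openConnIn ({o}ᶜ : Set V) i v}) ω ∂μ :=
              star_integral_nonneg w o i j hio (hao j hjA) ↑B F hF (hαle i j hij)
          _ ≤ ∫ ω in starEvent o ↑B, (f ω - d ω) ∂μ :=
              setIntegral_mono_on (hint _ _) (hint _ _) (hmeas _) fun ω hσ => by
                have h := star_diff_ge F hF hσ (Finset.mem_coe.2 hj) (hao j hjA) hio
                simp only [hf, hd]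
                linarith
    rw [hsumJ]
    calc (0 : ℝ) ≤ ∫ ω, d ω ∂μ := hΔ
      _ = ∑ B ∈ (insert z A).powerset, ∫ ω in starEvent o ↑B, d ω ∂μ := hsumD
      _ ≤ ∑ B ∈ (insert z A).powerset, ∫ ω in J ∩ starEvent o ↑B, f ω ∂μ := Finset.sum_le_sum hterm

end Q7Psi

end

end Summit.CriticalPhenomena.PercolationContinuityZ3.Theorems
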